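import Summits.QuantumFields.BalabanUV.Beta.GAN24.StripLegApriori
import Summits.QuantumFields.BalabanUV.Beta.GAN24.FineReadoutColumn

/-!
# `BalabanUV.Beta.GAN24.FineReadoutApriori` — binder row G-an2-4 / (CONV-C), S-slot located remainder «E3Shape», route «S3-fibre²»
# (gan24-p1 `SKELETON-S3.md` v0.3 §8, RATIFIED method of record for S3-L1∕(S3-1) = «(U2′) explicit-alias», node E3A3 part (a)(b) of
# `HOME/b2b-balaban-gan24-formalise-leaf-16/g8/E3A-READOUT.md` §2): WHERE THE SCALED ℓ² BOUND IS SHARP — the zero alias and the border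
# unknowns `(φ, c)` of the MINIMISER COLUMN, from (U1)+A of road P1 BY NAME

NOT IN PRINT; OUR PROOF ATTEMPT (of the road; THIS file is [folklore] bookkeeping: the minimiser column of the inverse Bloch fibre packed as an arrow
vector (leaf-16's `ArrowOperator.fibreFun_eq_iff_arrowMat`), gan24-p1's squared a-priori form `StripLegApriori.apriori_sq_of_scaledArrow` read term by term).
HONEST FRAMING (cell contract, verbatim): «discharging `BetaPertH` makes Bałaban's UV stability UNCONDITIONAL — a real constructive-QFT result; it is NOT the
continuum limit and NOT the Clay problem.»  HONEST DEPENDENCY (verbatim): «continuum YM on T⁴ ⇐ BetaPertH ∧ nine spine estimates (0/9 proved); BetaPertH ⇐ (D1) ∧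
(D4) ∧ CAP+tail; G-an2-4 gates asym, D1 and NE2/3/4.»  No cited fact, no wall binder, no `def … : Prop`; (U1)+A enter as HYPOTHESES (`IsUnit`, `‖inverse‖ ≤ A` of
the scaled arrow matrix — theorems of road P1 at d = 3 via `FibreDetStripHolds.exists_strip`, not imported: the file is generic in `D`); discharges NOTHING of
(hS, hSall) / «E3Shape»; NOT `BetaPertH`, NOT continuum, NOT Clay.

## What is proved (generic `d`, `D = d+1`, block side `N ≥ 1`, COMPLEX quasi-momentum `p` with `det F_N(p) ≠ 0`; radii `0 < r m`, `0 < r₀`)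
* §1 `packSrc_single_inr`: the sources of the multiplier unit column `e_{(Q,l)}` in arrow form are `pack 0 0 (Pi.single l 1) 0`; `sum_rhoR_sq_single`: their `ρ`-weighted
  square sum is `((N^{D})⁻¹… )` — precisely `(rhoR … (inr (inl l)))² = (N^(d+2))⁻²`.
* §2 (`fibreFun_fibInvCol_of_det` is E3A1's, BY NAME) `exists_arrow_column`: for SOME gauge constant `c`, the packed amplitudes `x = pack (ampA p v) (ampμ p v) (v∘inr∘inr) c` of the column
  `v = (i ↦ fibInv N i (inr (inr l)) p)` solve `arrowMat (aliasArrow N p) *ᵥ x = pack 0 0 e_l 0`.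
* §3 **`column_apriori`** — THE SHARP ℓ² CONSEQUENCES of `IsUnit (arrowMat (scaledArrow N r r₀ p))`, `‖inverse‖ ≤ A`: with that `c`,
  `‖ampA p v m κ‖ ≤ A·(N^{d+2})⁻¹` for EVERY alias `m` (in particular `m = 0`), `‖fibInv N (inr (inr κ)) (inr (inr l)) p‖ ≤ (r₀²/N³)·A·(N^{d+2})⁻¹`
  (the K-slot mm entries), `‖c‖ ≤ (r₀³/N³)·A·(N^{d+2})⁻¹` — design note §2(a)(b); the instances `r = radI, r₀ = 1` (inner) and `r = radO N q, r₀ = radO N q 0`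
  (outer) are the two cases of `FibreDetStripHolds.exists_strip`.
Unit `b2b-balaban-gan24-formalise-leaf-16` (G-an2-4 formalisation swarm, leaf prover 16, gen 8; records — idle-seat engine), 2026-08-20.
-/

noncomputable section

open Complex Finset Matrix
open scoped BigOperators Real Matrix.Norms.L2Operator
open Literature.Probability.LatticeModels (TorusSite)
open Literature.MathematicalPhysics.QuantumFieldTheory.Balaban1983to89
open Literature.MathematicalPhysics.QuantumFieldTheory.Balaban1983to89.Beta
open BlochFibreMatrix (Idx blochChar fibreFun fibreMatrix stencil pieceMatrix fibreMatrix_mulVec fibreMatrix_blochChar_eq_trigPolySymbol)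
open FibreInverseDecay (trigPolySymbol)
open Summit.QuantumFields.BalabanUV.Beta.GAN24.FibreDFTDictionary (ampA ampμ)
open Summit.QuantumFields.BalabanUV.Beta.GAN24.FibreArrow (srcEL srcG)
open Summit.QuantumFields.BalabanUV.Beta.GAN24.ArrowOperator (AIdx Loc arrowMat aliasArrow pack packSrc fibreFun_eq_iff_arrowMat)
open Summit.QuantumFields.BalabanUV.Beta.GAN24.ArrowScaling (scaledArrow)
open Summit.QuantumFields.BalabanUV.Beta.GAN24.StripLegApriori (sigmaR rhoR sigmaR_A sigmaR_phi rhoR_Q sigmaR_pos apriori_sq_of_scaledArrow)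
open Summit.QuantumFields.BalabanUV.Beta.GAN24.CombesThomasFibre (fibInv)
open Summit.QuantumFields.BalabanUV.Beta.GAN24.FibInvClosedForm (srcEL_single_inr srcG_single_inr single_inr_M single_inr_Q)
open Summit.QuantumFields.BalabanUV.Beta.GAN24.FineReadoutColumn (fibreFun_fibInvCol_of_det)

namespace Summit.QuantumFields.BalabanUV.Beta.GAN24.FineReadoutApriori

variable {d N : ℕ} [NeZero N]

/-! ## §1 The sources of the multiplier unit column in arrow form -/

/-- [folklore] `packSrc p e_{(Q,l)} = pack 0 0 e_l 0`: the multiplier unit column has no EL-, G- or M-source. -/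
theorem packSrc_single_inr (p : Fin (d + 1) → ℂ) (l : Fin (d + 1)) :
    packSrc p (Pi.single (M := fun _ : Idx (d + 1) N => ℂ) (Sum.inr (Sum.inr l)) (1 : ℂ))
      = pack (0 : TorusSite (d + 1) N → Fin (d + 1) → ℂ) (0 : TorusSite (d + 1) N → ℂ) (Pi.single l (1 : ℂ)) 0 := by
  unfold packSrc
  rw [srcEL_single_inr, srcG_single_inr, single_inr_M]
  congr 1
  funext κ; rw [single_inr_Q l κ, Pi.single_apply]

omit [NeZero N] in
/-- [folklore] The entries of `pack 0 0 e_l 0`: zero on every local slot and on the M slot, `e_l` on the Q slots. -/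
theorem pack_src_inl (l : Fin (d + 1)) (i : Loc (d + 1) × TorusSite (d + 1) N) :
    pack (0 : TorusSite (d + 1) N → Fin (d + 1) → ℂ) (0 : TorusSite (d + 1) N → ℂ) (Pi.single l (1 : ℂ)) 0 (Sum.inl i) = 0 := by
  rcases i with ⟨s | s, m⟩ <;> rfl

omit [NeZero N] in
/-- [folklore] The Q entries. -/
theorem pack_src_inr_inl (l κ : Fin (d + 1)) :
    pack (0 : TorusSite (d + 1) N → Fin (d + 1) → ℂ) (0 : TorusSite (d + 1) N → ℂ) (Pi.single l (1 : ℂ)) 0 (Sum.inr (Sum.inl κ)) = if κ = l then 1 else 0 := by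
  show (Pi.single l (1 : ℂ) : Fin (d + 1) → ℂ) κ = _; rw [Pi.single_apply]

omit [NeZero N] in
/-- [folklore] The M entry. -/
theorem pack_src_inr_inr (l : Fin (d + 1)) (u : Unit) :
    pack (0 : TorusSite (d + 1) N → Fin (d + 1) → ℂ) (0 : TorusSite (d + 1) N → ℂ) (Pi.single l (1 : ℂ)) 0 (Sum.inr (Sum.inr u)) = 0 := rfl

/-- [folklore] **THE WEIGHTED SQUARE SUM OF THE SOURCES**: `Σ_i (ρ_i‖(pack 0 0 e_l 0)_i‖)² = ((N^{d+2})⁻¹)²` (only the Q_l row contributes). -/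
theorem sum_rhoR_sq_single (r : TorusSite (d + 1) N → ℝ) (r0 : ℝ) (l : Fin (d + 1)) :
    ∑ i : AIdx (d + 1) (TorusSite (d + 1) N),
        (rhoR (d + 1) N r r0 i * ‖pack (0 : TorusSite (d + 1) N → Fin (d + 1) → ℂ) (0 : TorusSite (d + 1) N → ℂ) (Pi.single l (1 : ℂ)) 0 i‖) ^ 2
      = (((N : ℝ) ^ (d + 1 + 1))⁻¹) ^ 2 := by
  rw [Fintype.sum_sum_type]
  have h1 : ∑ i : Loc (d + 1) × TorusSite (d + 1) N,
      (rhoR (d + 1) N r r0 (Sum.inl i) * ‖pack (0 : TorusSite (d + 1) N → Fin (d + 1) → ℂ) (0 : TorusSite (d + 1) N → ℂ) (Pi.single l (1 : ℂ)) 0 (Sum.inl i)‖) ^ 2 = 0 :=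
    Finset.sum_eq_zero fun i _ => by rw [pack_src_inl, norm_zero, mul_zero, zero_pow two_ne_zero]
  rw [h1, zero_add, Fintype.sum_sum_type]
  have h2 : ∑ u : Unit,
      (rhoR (d + 1) N r r0 (Sum.inr (Sum.inr u)) * ‖pack (0 : TorusSite (d + 1) N → Fin (d + 1) → ℂ) (0 : TorusSite (d + 1) N → ℂ) (Pi.single l (1 : ℂ)) 0 (Sum.inr (Sum.inr u))‖) ^ 2 = 0 :=
    Finset.sum_eq_zero fun u _ => by rw [pack_src_inr_inr, norm_zero, mul_zero, zero_pow two_ne_zero]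
  rw [h2, add_zero, Finset.sum_eq_single l]
  · rw [pack_src_inr_inl, if_pos rfl, norm_one, mul_one, rhoR_Q]
  · intro κ _ hκ
    rw [pack_src_inr_inl, if_neg hκ, norm_zero, mul_zero, zero_pow two_ne_zero]
  · intro h; exact absurd (Finset.mem_univ l) h

/-! ## §2 The minimiser column as an arrow vector -/

/-- [folklore] **THE MINIMISER COLUMN AS AN ARROW VECTOR**: for some gauge constant `c`, the packed amplitudes of the column `v = F_N(p)⁻¹ e_{(Q,l)}`
solve `arrowMat (aliasArrow N p) *ᵥ pack (ampA p v) (ampμ p v) (v∘inr∘inr) c = pack 0 0 e_l 0`. -/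
theorem exists_arrow_column (p : Fin (d + 1) → ℂ)
    (hdet : (trigPolySymbol (stencil (d + 1)) (pieceMatrix (N := N)) p).det ≠ 0) (l : Fin (d + 1)) :
    ∃ c : ℂ, arrowMat (aliasArrow N p) *ᵥ
        pack (ampA p (fun i => fibInv N i (Sum.inr (Sum.inr l)) p)) (ampμ p (fun i => fibInv N i (Sum.inr (Sum.inr l)) p))
          (fun κ => fibInv N (Sum.inr (Sum.inr κ)) (Sum.inr (Sum.inr l)) p) c
      = pack (0 : TorusSite (d + 1) N → Fin (d + 1) → ℂ) (0 : TorusSite (d + 1) N → ℂ) (Pi.single l (1 : ℂ)) 0 := by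
  obtain ⟨c, hc⟩ := (fibreFun_eq_iff_arrowMat p _ _).mp (fibreFun_fibInvCol_of_det p hdet (Sum.inr (Sum.inr l)))
  exact ⟨c, by rw [hc, packSrc_single_inr]⟩

/-! ## §3 The sharp ℓ² consequences of (U1)+A -/

/-- [folklore] ONE TERM of the a-priori form: `‖x i‖ ≤ σ_i · A · (N^{d+2})⁻¹` for every arrow index `i`, when `arrowMat (aliasArrow N p) x = pack 0 0 e_l 0`. -/
theorem norm_apply_le_of_apriori {r : TorusSite (d + 1) N → ℝ} (hr : ∀ m, 0 < r m) {r0 : ℝ} (hr0 : 0 < r0) (p : Fin (d + 1) → ℂ) {A : ℝ} (hA0 : 0 ≤ A)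
    (hU : IsUnit (arrowMat (scaledArrow N r r0 p))) (hA : ‖(arrowMat (scaledArrow N r r0 p))⁻¹‖ ≤ A)
    {x : AIdx (d + 1) (TorusSite (d + 1) N) → ℂ} {l : Fin (d + 1)}
    (hx : arrowMat (aliasArrow N p) *ᵥ x = pack (0 : TorusSite (d + 1) N → Fin (d + 1) → ℂ) (0 : TorusSite (d + 1) N → ℂ) (Pi.single l (1 : ℂ)) 0)
    (i : AIdx (d + 1) (TorusSite (d + 1) N)) :
    ‖x i‖ ≤ sigmaR N r r0 i * A * ((N : ℝ) ^ (d + 1 + 1))⁻¹ := by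
  have h := apriori_sq_of_scaledArrow hr hr0 p hU hA x
  rw [hx, sum_rhoR_sq_single] at h
  have hσ : 0 < sigmaR N r r0 i := sigmaR_pos (D := d + 1) (Nat.pos_of_ne_zero (NeZero.ne N)) hr hr0 i
  have hterm : (‖x i‖ / sigmaR N r r0 i) ^ 2 ≤ A ^ 2 * (((N : ℝ) ^ (d + 1 + 1))⁻¹) ^ 2 :=
    (Finset.single_le_sum (f := fun i => (‖x i‖ / sigmaR N r r0 i) ^ 2) (fun i _ => sq_nonneg _) (Finset.mem_univ i)).trans h
  have hN : (0 : ℝ) ≤ ((N : ℝ) ^ (d + 1 + 1))⁻¹ := by positivity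
  have hle : ‖x i‖ / sigmaR N r r0 i ≤ A * ((N : ℝ) ^ (d + 1 + 1))⁻¹ :=
    (pow_le_pow_iff_left₀ (div_nonneg (norm_nonneg _) hσ.le) (mul_nonneg hA0 hN) two_ne_zero).1 (by rw [mul_pow]; exact hterm)
  rw [div_le_iff₀ hσ] at hle
  linarith [hle]

/-- [folklore] **THE MINIMISER COLUMN UNDER (U1)+A — WHERE ℓ² IS SHARP** (design note §2(a)(b)): for some gauge constant `c`, the arrow equation of §2 holds AND
`‖Â_{mκ}‖ ≤ A·(N^{d+2})⁻¹` for every alias `m` (the zero alias included), `‖wΦ̂_{κl}‖ = ‖fibInv N (inr (inr κ)) (inr (inr l)) p‖ ≤ (r₀²/N³)·A·(N^{d+2})⁻¹`,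
`‖c‖ ≤ (r₀³/N³)·A·(N^{d+2})⁻¹`. -/
theorem column_apriori {r : TorusSite (d + 1) N → ℝ} (hr : ∀ m, 0 < r m) {r0 : ℝ} (hr0 : 0 < r0) (p : Fin (d + 1) → ℂ) {A : ℝ} (hA0 : 0 ≤ A)
    (hdet : (trigPolySymbol (stencil (d + 1)) (pieceMatrix (N := N)) p).det ≠ 0)
    (hU : IsUnit (arrowMat (scaledArrow N r r0 p))) (hA : ‖(arrowMat (scaledArrow N r r0 p))⁻¹‖ ≤ A) (l : Fin (d + 1)) :
    ∃ c : ℂ,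
      arrowMat (aliasArrow N p) *ᵥ
          pack (ampA p (fun i => fibInv N i (Sum.inr (Sum.inr l)) p)) (ampμ p (fun i => fibInv N i (Sum.inr (Sum.inr l)) p))
            (fun κ => fibInv N (Sum.inr (Sum.inr κ)) (Sum.inr (Sum.inr l)) p) c
        = pack (0 : TorusSite (d + 1) N → Fin (d + 1) → ℂ) (0 : TorusSite (d + 1) N → ℂ) (Pi.single l (1 : ℂ)) 0 ∧
      (∀ (m : TorusSite (d + 1) N) (κ : Fin (d + 1)),
          ‖ampA p (fun i => fibInv N i (Sum.inr (Sum.inr l)) p) m κ‖ ≤ A * ((N : ℝ) ^ (d + 1 + 1))⁻¹) ∧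
      (∀ κ : Fin (d + 1), ‖fibInv N (Sum.inr (Sum.inr κ)) (Sum.inr (Sum.inr l)) p‖ ≤ r0 ^ 2 / (N : ℝ) ^ 3 * A * ((N : ℝ) ^ (d + 1 + 1))⁻¹) ∧
      ‖c‖ ≤ r0 ^ 3 / (N : ℝ) ^ 3 * A * ((N : ℝ) ^ (d + 1 + 1))⁻¹ := by
  obtain ⟨c, hx⟩ := exists_arrow_column p hdet l
  refine ⟨c, hx, fun m κ => ?_, fun κ => ?_, ?_⟩
  · have h := norm_apply_le_of_apriori hr hr0 p hA0 hU hA hx (Sum.inl (Sum.inl κ, m))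
    rw [sigmaR_A, one_mul] at h
    exact h
  · have h := norm_apply_le_of_apriori hr hr0 p hA0 hU hA hx (Sum.inr (Sum.inl κ))
    rw [sigmaR_phi] at h
    exact h
  · have h := norm_apply_le_of_apriori hr hr0 p hA0 hU hA hx (Sum.inr (Sum.inr ()))
    exact h

end Summit.QuantumFields.BalabanUV.Beta.GAN24.FineReadoutApriori

end
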